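import Literature.AlgebraicGeometry.HodgeTheory.CycleClassVanishingOfHodgePairing
import Literature.AlgebraicGeometry.HodgeTheory.ComplexOrientationCycleClassFacts
import Literature.AlgebraicGeometry.HodgeTheory.CycleClassPushforward
import Literature.AlgebraicGeometry.HodgeTheory.AlgebraicClassesHodgeTypeHolds
import Literature.AlgebraicGeometry.HodgeTheory.GysinFormalismHodgeOfGysin
import Literature.AlgebraicGeometry.HodgeTheory.HolomorphicBundleChernCharacterProjectiveSpace
import Literature.AlgebraicGeometry.Motives.CyclesPushforwardProofs
import Literature.AlgebraicTopology.SingularHomology.GysinTransposition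
import HarnessLib

/-!
# The cycle class of a principal divisor on a smooth projective variety vanishes, granted the
# degree formula, the case of projective space, and the spanning of the top Hodge classes by
# pull-backs from projective space

Family `hodge`, layer `Literature/AlgebraicGeometry/HodgeTheory`. C. Voisin, *Hodge Theory and Complex
Algebraic Geometry II* (2003), Lemma 9.18: "If `Z` is rationally equivalent to `0`, then `[Z] = 0`",
for the tree's real cycle class `cycleClass μ` through desingularisations (Voisin I §11.1.4, file
`CycleClassOfResolutions`) and the complex orientation family `μ = complexOrientationFamily`, in the
generator form `[div φ] = 0` recorded as the hypothesis predicate `OrientationFamily.CycleClassDivEqZero`.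
This file proves the CASE OF A SMOOTH PROJECTIVE AMBIENT `T` of dimension `d + 1` (`W = T`,
`φ ∈ K(T)ˣ`, `[div φ] ∈ H²(T(ℂ); ℂ)`) — to which the general case reduces by desingularising `W`
(Voisin's printed proof: "Let `τ : W̃ → X` be a desingularization […] `[Z] = τ_*[Z̃]`", sequel file) —
by the HODGE INDEX THEOREM instead of the Thom class of the divisor:

1. `x = [div φ]` is a rational class of Hodge type `(1,1)` (`isRationalClass_cycleClass`,
   `cycleClass_mem_algebraicClasses` + `isOfHodgeType_of_mem_algebraicClasses_of_isSmoothProjective`);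
2. by the perfect pairing on Hodge classes (`eq_zero_of_forall_kroneckerPairing_cupProduct_hodgeClass_eq_zero`,
   file `CycleClassVanishingOfHodgePairing`; Voisin I Thm. 6.32, BFNP 2009 (6.1)) it suffices that
   `⟨x ∪ a, [T(ℂ)]⟩ = 0` for every rational `(d,d)`-class `a ∈ H^{2d}(T(ℂ); ℂ)`;
3. such `a` are `ℂ`-combinations of pull-backs `F^* u`, `F : T ⟶ ℙ^{d+1}` a morphism,
   `u ∈ H^{2d}(ℙ^{d+1}(ℂ); ℂ)` — hard Lefschetz, Lefschetz `(1,1)` and the openness of the ample cone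
   (Voisin I Thm. 6.25, Thm. 11.30; Hartshorne II Thm. 7.1 and Ex. 7.5);
   this is the hypothesis predicate `TopHodgeClassesSpannedByPullbacks d T` (D-0014, nothing asserted here);
4. `⟨x ∪ F^* u, [T(ℂ)]⟩ = ⟨F_* x ∪ u, [ℙ^{d+1}(ℂ)]⟩` (transposition by Poincaré duality,
   `cupPairing_gysinMap`) and `F_* [div φ] = [F_* div φ]` (Prop. 9.21 (ii), the tree's
   `cycleClass_cyclesOfDimMap`, granted the degree formula `μ.HasDegreeFormula`), where
   `F_* div φ ∈ Rat_d(ℙ^{d+1})` (Fulton Thm. 1.4, the tree's theorem `map_mem_ratTrivial_holds`);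
5. and `[Z] = 0` for `Z ∈ Rat_d(ℙ^{d+1})` — Lemma 9.18 ON PROJECTIVE SPACE, the hypothesis predicate
   `ProjectiveSpaceCycleClassDivEqZero d` (generator form, as `CycleClassDivEqZero` restricted to
   `X = ℙ^{d+1}`, `e = 1`), discharged in the sequel from the degree formula.

Main results (everything PROVED relative to the displayed hypotheses; the only definitions are the two
hypothesis predicates):

* `isRationalClass_cycleClass` — cycle classes for the complex orientation family are rational;
* `kroneckerPairing_cupProduct_cycleClass_map` — step 4;
* `cycleClass_eq_zero_of_mem_ratTrivial_of_generators` — `[·]` kills `Rat_d X` once it kills its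
  generators;
* `cycleClass_div_eq_zero_of_projectiveSpace` — **`[div φ] = 0` in `H²(T(ℂ); ℂ)` for `T` smooth
  projective of dimension `d + 1`, granted `HasDegreeFormula`, `ProjectiveSpaceCycleClassDivEqZero d`
  and `TopHodgeClassesSpannedByPullbacks d T`.**

## References

* [VoisinHodgeII2003] C. Voisin, Hodge Theory and Complex Algebraic Geometry II, CUP 2003, Lemma 9.18,
  Prop. 9.21 (ii).
* [VoisinHodgeI2002] C. Voisin, Hodge Theory and Complex Algebraic Geometry I, CUP 2002, Thm. 6.25,
  Thm. 6.32, Thm. 11.30, §11.1.4.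
* [BrosnanFangNiePearlstein2009] P. Brosnan, H. Fang, Z. Nie, G. Pearlstein, Invent. Math. 177 (2009),
  §6 (6.1).
* [Fulton1998] W. Fulton, Intersection Theory, 2nd ed. 1998, §1.3, Thm. 1.4, Lemma 19.1.2.
* [Hartshorne1977] R. Hartshorne, Algebraic Geometry, Springer 1977, II Thm. 7.1, II Ex. 7.5.
* [FultonYoungTableaux1997] W. Fulton, Young Tableaux, CUP 1997, App. B §B.1 (5).
-/

noncomputable section

open CategoryTheory AlgebraicGeometry Order
open Literature.AlgebraicTopology.SingularHomology

namespace Literature.AlgebraicGeometry.HodgeTheory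

section HodgeTheory

open Literature.AlgebraicGeometry.Motives (projectiveSpace IsSmoothProjective)

variable {m n : ℕ} {T X : Motives.SchemeOver ℂ}

/-! ### Rationality of the cycle class -/

/-- **Cycle classes are rational** for the complex orientation family: `[Z] = Σ_z Z(z) • τ_z* 1` with
`τ_z* 1` rational (`isRationalClass_complexGysin_complexOrientationFamily`, `1` being rational).
[cite: VoisinHodgeI2002, §7.3.2 and §11.1.4] -/
theorem isRationalClass_cycleClass (hX : IsSmoothProjective n X) {d e : ℕ} (hde : d + e = n)
    (ρ : ResolutionFamily X d) (Z : ↥(Motives.cyclesOfDim X.left d)) :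
    IsRationalClass (cycleClass complexOrientationFamily hX hde ρ Z) := by
  rw [cycleClass_eq_sum complexOrientationFamily hX hde ρ Z
    (s := (finite_support_of_isSmoothProjective hX Z).toFinset) (by simp)]
  have h : ∀ z ∈ (finite_support_of_isSmoothProjective hX (Z : AlgebraicCycle X.left ℤ)).toFinset,
      (((Z : AlgebraicCycle X.left ℤ) z : ℤ) : ℂ) • primeClass complexOrientationFamily hX hde ρ z =
        ((((Z : AlgebraicCycle X.left ℤ) z : ℚ) : ℚ) : ℂ) •
          primeClass complexOrientationFamily hX hde ρ z := by
    intro z _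
    rw [Rat.cast_intCast]
  rw [Finset.sum_congr rfl h]
  refine IsRationalClass.sum_smul _ (fun z ↦ ?_) _
  by_cases hz : height z = (d : ℕ∞)
  · rw [primeClass_of_height_eq complexOrientationFamily hX hde ρ hz]
    exact isRationalClass_complexGysin_complexOrientationFamily (ρ.smooth ⟨z, hz⟩) hX (ρ.hom ⟨z, hz⟩) _
      (isRationalClass_one _)
  · rw [primeClass_of_height_ne complexOrientationFamily hX hde ρ hz]
    exact IsRationalClass.zero

/-! ### Transposition: `⟨[Z] ∪ F^* u, [T]⟩ = ⟨[F_* Z] ∪ u, [X]⟩` -/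

/-- **`⟨[Z] ∪ F^* u, [T(ℂ)]⟩ = ⟨[F_* Z] ∪ u, [X(ℂ)]⟩`** for a morphism `F : T ⟶ X` of smooth projective
varieties of the SAME dimension `d + 1`, a `d`-cycle `Z` on `T` and `u ∈ H^{2d}(X(ℂ); ℂ)`: transposition
by Poincaré duality (`⟨F_* y ∪ u, [X]⟩ = ⟨y ∪ F^* u, [T]⟩`, `cupPairing_gysinMap`) and Prop. 9.21 (ii)
`F_* [Z] = [F_* Z]` (`cycleClass_cyclesOfDimMap`, granted the degree formula for the complex orientation
family). [cite: VoisinHodgeII2003, Prop. 9.21 (ii)] [cite: Fulton1998, Lemma 19.1.2]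
[cite: FultonYoungTableaux1997, Appendix B §B.1 (5)] -/
theorem kroneckerPairing_cupProduct_cycleClass_map (hA : complexOrientationFamily.HasDegreeFormula)
    {d : ℕ} (hT : IsSmoothProjective (d + 1) T) (hX : IsSmoothProjective (d + 1) X) (F : T ⟶ X)
    [QuasiCompact F.left] (ρ : ResolutionFamily T d) (ρ' : ResolutionFamily X d)
    (Z : ↥(Motives.cyclesOfDim T.left d)) (u : complexBetti X (2 * d)) :
    kroneckerPairing ℂ ℂ (Motives.ComplexPoints T) (2 * (d + 1))
        (cupProduct (show 2 * 1 + 2 * d = 2 * (d + 1) by ring)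
          (cycleClass complexOrientationFamily hT rfl ρ Z) (complexBetti.map F (2 * d) u))
        (complexOrientationFamily hT).fundamentalClass =
      kroneckerPairing ℂ ℂ (Motives.ComplexPoints X) (2 * (d + 1))
        (cupProduct (show 2 * 1 + 2 * d = 2 * (d + 1) by ring)
          (cycleClass complexOrientationFamily hX rfl ρ' (Motives.cyclesOfDimMap d F.left Z)) u)
        (complexOrientationFamily hX).fundamentalClass := by
  have hPD : complexOrientationFamily.HasPoincareDuality := hasPoincareDuality_complexOrientationFamily
  have h1 := cycleClass_cyclesOfDimMap hA hT hX F (rfl : d + 1 = d + 1) (rfl : d + 1 = d + 1) ρ ρ' Z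
  have h2 : complexGysin complexOrientationFamily hT hX F
        (show 2 * 1 + 2 * (d + 1) = 2 * 1 + 2 * (d + 1) from rfl) =
      gysinMap (complexOrientationFamily hT) (complexOrientationFamily hX)
        (Motives.AlgPoints.mapContinuous (L := ℂ) F) (q := 2 * d)
        (show 2 * 1 + 2 * d = 2 * (d + 1) by ring) (show 2 * 1 + 2 * d = 2 * (d + 1) by ring) :=
    complexGysin_eq_gysinMap hT hX F _ _ _
  have h3 := cupPairing_gysinMap (μY := complexOrientationFamily hT) (hPD hX)
    (Motives.AlgPoints.mapContinuous (L := ℂ) F)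
    (show 2 * 1 + 2 * d = 2 * (d + 1) by ring) (show 2 * 1 + 2 * d = 2 * (d + 1) by ring)
    (cycleClass complexOrientationFamily hT rfl ρ Z) u
  rw [cupPairing_apply, cupPairing_apply] at h3
  rw [h1, h2]
  exact h3.symm

/-! ### `[·]` kills `Rat_d X` once it kills the generators -/

/-- **`[Z] = 0` for all `Z ∈ Rat_d X` as soon as `[div φ] = 0` for the generators** (`Rat_d X` is the
subgroup generated by the `div φ`, `Motives.ratTrivial`, and the cycle class is additive).
[cite: Fulton1998, §1.3] [cite: VoisinHodgeII2003, Lemma 9.18] -/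
theorem cycleClass_eq_zero_of_mem_ratTrivial_of_generators (μ : OrientationFamily)
    (hX : IsSmoothProjective n X) {d e : ℕ} (hde : d + e = n) (ρ : ResolutionFamily X d)
    (hgen : ∀ ⦃c : AlgebraicCycle X.left ℤ⦄, c ∈ Motives.ratEquivGenerators X.left d →
      ∀ hc : c ∈ Motives.cyclesOfDim X.left d, cycleClass μ hX hde ρ ⟨c, hc⟩ = 0)
    {c : AlgebraicCycle X.left ℤ} (hc : c ∈ Motives.ratTrivial X.left d)
    (hc' : c ∈ Motives.cyclesOfDim X.left d) : cycleClass μ hX hde ρ ⟨c, hc'⟩ = 0 := by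
  revert hc'
  induction hc using AddSubgroup.closure_induction with
  | mem c hc => intro hc'; exact hgen hc hc'
  | zero => intro hc'; exact map_zero (cycleClass μ hX hde ρ)
  | add a b ha hb iha ihb =>
    intro hab
    have ha' : a ∈ Motives.cyclesOfDim X.left d := Motives.ratTrivial_le_cyclesOfDim X.left d ha
    have hb' : b ∈ Motives.cyclesOfDim X.left d := Motives.ratTrivial_le_cyclesOfDim X.left d hb
    have h : (⟨a + b, hab⟩ : ↥(Motives.cyclesOfDim X.left d)) = ⟨a, ha'⟩ + ⟨b, hb'⟩ := rfl
    rw [h, map_add, iha ha', ihb hb', add_zero]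
  | neg a ha iha =>
    intro hna
    have ha' : a ∈ Motives.cyclesOfDim X.left d := Motives.ratTrivial_le_cyclesOfDim X.left d ha
    have h : (⟨-a, hna⟩ : ↥(Motives.cyclesOfDim X.left d)) = -⟨a, ha'⟩ := rfl
    rw [h, map_neg, iha ha', neg_zero]

/-! ### The two hypothesis predicates -/

/-- **Lemma 9.18 on projective space, generator form** (hypothesis predicate, D-0014; nothing is
asserted): for every resolution family `ρ` in dimension `d` on `ℙ^{d+1}_ℂ`, every closed subvariety
`W ⊆ ℙ^{d+1}` of dimension `d + 1` (i.e. `W = ℙ^{d+1}`) and every `φ ∈ K(W)`, `φ ≠ 0`, the `d`-cycle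
`div φ` has cycle class `[div φ] = 0 ∈ H²(ℙ^{d+1}(ℂ); ℂ)` for the complex orientation family — the
predicate `OrientationFamily.CycleClassDivEqZero` at `X = ℙ^{d+1}`, `e = 1`. In print: a rational
function on `ℙ^{d+1}` is a quotient `G₁/G₂` of forms of the same degree and the class of a hypersurface
of degree `g` is `g` times the class of a hyperplane. [cite: VoisinHodgeII2003, Lemma 9.18]
[cite: Fulton1998, §1.3 and §19.1] -/
def ProjectiveSpaceCycleClassDivEqZero (d : ℕ) : Prop :=
  ∀ (ρ : ResolutionFamily (projectiveSpace (d + 1) ℂ) d)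
    (W : Motives.ClosedSubvariety (projectiveSpace (d + 1) ℂ).left) [IsLocallyNoetherian W.carrier]
    (φ : W.carrier.functionField), φ ≠ 0 → W.dim = d + 1 →
    ∀ ⦃c : AlgebraicCycle (projectiveSpace (d + 1) ℂ).left ℤ⦄
      (hc : c ∈ Motives.cyclesOfDim (projectiveSpace (d + 1) ℂ).left d), ⇑c = W.divFun φ →
      cycleClass complexOrientationFamily (isSmoothProjective_projectiveSpace' (d + 1)) rfl ρ ⟨c, hc⟩ = 0

/-- **The rational `(d,d)`-classes of a `(d+1)`-fold are spanned by pull-backs from `ℙ^{d+1}`**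
(hypothesis predicate, D-0014; nothing is asserted): every rational class `a ∈ H^{2d}(T(ℂ); ℂ)` of Hodge
type `(d,d)` is a `ℂ`-linear combination of classes `F^* u`, `F : T ⟶ ℙ^{d+1}_ℂ` a morphism,
`u ∈ H^{2d}(ℙ^{d+1}(ℂ); ℂ)`. For `T` smooth projective of dimension `d + 1` this holds: the rational
`(d,d)`-classes are `Lᵈ⁻¹` of the rational `(1,1)`-classes (hard Lefschetz, Voisin I Thm. 6.25), which
are the `ℚ`-span of the classes of very ample divisors (Lefschetz `(1,1)`, Voisin I Thm. 11.30, and the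
openness of the ample cone), and products of `d` such classes are combinations of `d`-th powers
`c₁(L)ᵈ = (F_L^* c₁(𝒪(1)))ᵈ`, `F_L : T → ℙ^{d+1}` defined by `d + 2` general sections of the globally
generated `L` (Voisin I Thm. 7.10, Hartshorne II Thm. 7.1). [cite: VoisinHodgeI2002, Thm. 6.25, Thm. 7.10 and Thm. 11.30]
[cite: Hartshorne1977, II Thm. 7.1 and II Ex. 7.5] -/
def TopHodgeClassesSpannedByPullbacks (d : ℕ) (T : Motives.SchemeOver ℂ) : Prop :=
  ∀ a : complexBetti T (2 * d), IsRationalClass a → IsOfHodgeType (d + 1) T (2 * d) d d a →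
    a ∈ Submodule.span ℂ {b : complexBetti T (2 * d) |
      ∃ (F : T ⟶ projectiveSpace (d + 1) ℂ) (u : complexBetti (projectiveSpace (d + 1) ℂ) (2 * d)),
        b = complexBetti.map F (2 * d) u}

/-! ### The case of a smooth projective ambient variety -/

/-- **`⟨[div φ] ∪ F^* u, [T(ℂ)]⟩ = 0`** for `T` smooth projective of dimension `d + 1`, a generator
`c = div φ` of `Rat_d T`, a morphism `F : T ⟶ ℙ^{d+1}` and `u ∈ H^{2d}(ℙ^{d+1}(ℂ); ℂ)`, granted the
degree formula and Lemma 9.18 on `ℙ^{d+1}`: by transposition the pairing is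
`⟨[F_* div φ] ∪ u, [ℙ^{d+1}]⟩`, and `F_* div φ ∈ Rat_d(ℙ^{d+1})` (Fulton Thm. 1.4, the tree's theorem
`map_mem_ratTrivial_holds`) has class `0`. [cite: VoisinHodgeII2003, Lemma 9.18 and Prop. 9.21 (ii)]
[cite: Fulton1998, Thm. 1.4] -/
theorem kroneckerPairing_cupProduct_cycleClass_map_eq_zero_of_mem_ratTrivial
    (hA : complexOrientationFamily.HasDegreeFormula) {d : ℕ} (hP : ProjectiveSpaceCycleClassDivEqZero d)
    (hT : IsSmoothProjective (d + 1) T) (ρ : ResolutionFamily T d) {c : AlgebraicCycle T.left ℤ}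
    (hc : c ∈ Motives.ratTrivial T.left d) (hc' : c ∈ Motives.cyclesOfDim T.left d)
    (F : T ⟶ projectiveSpace (d + 1) ℂ) (u : complexBetti (projectiveSpace (d + 1) ℂ) (2 * d)) :
    kroneckerPairing ℂ ℂ (Motives.ComplexPoints T) (2 * (d + 1))
        (cupProduct (show 2 * 1 + 2 * d = 2 * (d + 1) by ring)
          (cycleClass complexOrientationFamily hT rfl ρ ⟨c, hc'⟩) (complexBetti.map F (2 * d) u))
        (complexOrientationFamily hT).fundamentalClass = 0 := by
  have hPP : IsSmoothProjective (d + 1) (projectiveSpace (d + 1) ℂ) :=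
    isSmoothProjective_projectiveSpace' (d + 1)
  haveI : IsProper F.left := isProper_left_of_isSmoothProjective hT hPP F
  haveI : QuasiCompact F.left := inferInstance
  haveI : LocallyOfFiniteType T.hom := locallyOfFiniteType_of_isSmoothProjective hT
  haveI : LocallyOfFiniteType (projectiveSpace (d + 1) ℂ).hom := locallyOfFiniteType_of_isSmoothProjective hPP
  obtain ⟨ρ'⟩ := nonempty_resolutionFamily hPP d
  rw [kroneckerPairing_cupProduct_cycleClass_map hA hT hPP F ρ ρ' ⟨c, hc'⟩ u]
  have hmem : AlgebraicCycle.map F.left height height c ∈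
      Motives.ratTrivial (projectiveSpace (d + 1) ℂ).left d :=
    Motives.map_mem_ratTrivial_holds d F hc
  have hzero : cycleClass complexOrientationFamily hPP rfl ρ' (Motives.cyclesOfDimMap d F.left ⟨c, hc'⟩) = 0 :=
    cycleClass_eq_zero_of_mem_ratTrivial_of_generators complexOrientationFamily hPP rfl ρ'
      (fun c hc hc' ↦ by
        obtain ⟨-, W, _, φ, hφ, hW, hcφ⟩ := hc
        exact hP ρ' W φ hφ hW hc' hcφ)
      hmem _
  rw [hzero, map_zero, LinearMap.zero_apply, map_zero, LinearMap.zero_apply]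

/-- **The cycle class of a principal divisor on a smooth projective variety vanishes** — Voisin II,
Lemma 9.18 in generator form for the complex orientation family, in the case of a SMOOTH projective
ambient `T` of dimension `d + 1` (`W ⊆ T` a closed subvariety of dimension `d + 1`, i.e. `W = T`;
`φ ∈ K(W)`, `φ ≠ 0`; `[div φ] = 0` in `H²(T(ℂ); ℂ)` for every resolution family), GRANTED: the degree
formula `HasDegreeFormula` for the complex orientations (Fulton Lemma 19.1.2), Lemma 9.18 on `ℙ^{d+1}`
(`ProjectiveSpaceCycleClassDivEqZero d`) and the spanning of the rational `(d,d)`-classes of `T` by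
pull-backs from `ℙ^{d+1}` (`TopHodgeClassesSpannedByPullbacks d T`). Proof: `[div φ]` is a rational
`(1,1)`-class pairing to zero with every `F^* u` (previous theorem), hence with every rational
`(d,d)`-class, hence is `0` by the perfect pairing on Hodge classes (Hodge index).
[cite: VoisinHodgeII2003, Lemma 9.18] [cite: VoisinHodgeI2002, Thm. 6.32 and §7.1.2]
[cite: BrosnanFangNiePearlstein2009, §6 (6.1)] -/
theorem cycleClass_div_eq_zero_of_projectiveSpace (hA : complexOrientationFamily.HasDegreeFormula)
    {d : ℕ} (hP : ProjectiveSpaceCycleClassDivEqZero d) (hT : IsSmoothProjective (d + 1) T)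
    (hS : TopHodgeClassesSpannedByPullbacks d T) (ρ : ResolutionFamily T d)
    (W : Motives.ClosedSubvariety T.left) [IsLocallyNoetherian W.carrier] (φ : W.carrier.functionField)
    (hφ : φ ≠ 0) (hW : W.dim = d + 1) {c : AlgebraicCycle T.left ℤ} (hc : c ∈ Motives.cyclesOfDim T.left d)
    (hcφ : ⇑c = W.divFun φ) : cycleClass complexOrientationFamily hT rfl ρ ⟨c, hc⟩ = 0 := by
  set x := cycleClass complexOrientationFamily hT rfl ρ ⟨c, hc⟩ with hx
  -- (1) `x` is a rational `(1,1)`-class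
  have hxr : IsRationalClass x := isRationalClass_cycleClass hT rfl ρ ⟨c, hc⟩
  have hx11 : IsOfHodgeType (d + 1) T (2 * 1) 1 1 x :=
    isOfHodgeType_of_mem_algebraicClasses_of_isSmoothProjective hT 1
      (cycleClass_mem_algebraicClasses complexOrientationFamily hT rfl ρ ⟨c, hc⟩)
  -- (4)–(5) `x` pairs to zero with every pull-back `F^* u`
  have hcrat : c ∈ Motives.ratTrivial T.left d :=
    AddSubgroup.subset_closure ⟨hc, W, ‹_›, φ, hφ, hW, hcφ⟩
  have hpair : ∀ (F : T ⟶ projectiveSpace (d + 1) ℂ) (u : complexBetti (projectiveSpace (d + 1) ℂ) (2 * d)),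
      kroneckerPairing ℂ ℂ (Motives.ComplexPoints T) (2 * (d + 1))
        (cupProduct (show 2 * 1 + 2 * d = 2 * (d + 1) by ring) x (complexBetti.map F (2 * d) u))
        (complexOrientationFamily hT).fundamentalClass = 0 :=
    fun F u ↦ kroneckerPairing_cupProduct_cycleClass_map_eq_zero_of_mem_ratTrivial hA hP hT ρ hcrat hc F u
  -- (3) hence with every rational `(d,d)`-class, by the spanning hypothesis and linearity
  have hall : ∀ a : complexBetti T (2 * d), IsRationalClass a → IsOfHodgeType (d + 1) T (2 * d) d d a →
      kroneckerPairing ℂ ℂ (Motives.ComplexPoints T) (2 * (d + 1))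
        (cupProduct (show 2 * 1 + 2 * d = 2 * (d + 1) by ring) x a)
        (complexOrientationFamily hT).fundamentalClass = 0 := by
    intro a ha ha'
    -- the functional `a ↦ ⟨x ∪ a, [T]⟩` is linear and kills the spanning set
    let Φ : complexBetti T (2 * d) →ₗ[ℂ] ℂ :=
      (kroneckerPairing ℂ ℂ (Motives.ComplexPoints T) (2 * (d + 1))).flip
          (complexOrientationFamily hT).fundamentalClass ∘ₗ
        cupProduct (show 2 * 1 + 2 * d = 2 * (d + 1) by ring) x
    have hΦ : ∀ b ∈ {b : complexBetti T (2 * d) |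
        ∃ (F : T ⟶ projectiveSpace (d + 1) ℂ) (u : complexBetti (projectiveSpace (d + 1) ℂ) (2 * d)),
          b = complexBetti.map F (2 * d) u}, Φ b = 0 := by
      rintro b ⟨F, u, rfl⟩
      exact hpair F u
    have hker : Submodule.span ℂ {b : complexBetti T (2 * d) |
        ∃ (F : T ⟶ projectiveSpace (d + 1) ℂ) (u : complexBetti (projectiveSpace (d + 1) ℂ) (2 * d)),
          b = complexBetti.map F (2 * d) u} ≤ LinearMap.ker Φ :=
      Submodule.span_le.2 fun b hb ↦ LinearMap.mem_ker.2 (hΦ b hb)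
    have h0 : Φ a = 0 := LinearMap.mem_ker.1 (hker (hS a ha ha'))
    exact h0
  -- (2) the perfect pairing on Hodge classes
  exact eq_zero_of_forall_kroneckerPairing_cupProduct_hodgeClass_eq_zero (m := d + 1) hT
    (Nat.le_add_left 1 d) hxr hx11 hall

end HodgeTheory

end Literature.AlgebraicGeometry.HodgeTheory

end
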